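import Literature.NumberTheory.NumberFields.ChevalleyVUnitCongruenceProofs
import Literature.NumberTheory.DiophantineGeometry.SUnitTheorem
import HarnessLib

/-!
# Chevalley 1951, Théorème 1 for an arbitrary finitely generated subgroup `E ≤ Kˣ` — proof
(proofs file; discharges the named fact `Chevalley1951.thm1` of `ChevalleyUnitCongruence.lean`)

C. Chevalley, *Deux théorèmes d'arithmétique*, J. Math. Soc. Japan **3** (1951) 36–44
[ChevalleyDeuxTheoremes1951], Théorème 1 (p. 36): «Soient `K` un corps de nombres algébriques de degré
fini, et `E` un sous-groupe à engendrement fini du groupe multiplicatif des éléments `≠ 0` de `K`. Soit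
`m` un entier `> 0`, et soit `N` un entier rationnel quelconque. Il existe un entier rationnel `a`,
premier à `N`, qui jouit de la propriété suivante: tout élément `x` de `E` qui est `≡ 1 (mod a)` est
puissance `m`-ième d'un élément de `E`» — the congruence in the sense of Hasse's multiplicative
congruences: `x - 1 = a y / z` with `y, z` integers of `K` and `z` prime to `a`.

The tree states this as the named fact `Literature.NumberTheory.NumberFields.Chevalley1951.thm1`
(`ChevalleyUnitCongruence.lean`) and PROVES its two special cases used downstream: the unit group
`E = 𝓞_Kˣ` (`Chevalley1951.thm1_units_holds`, `ChevalleyUnitCongruenceProofs.lean`) and the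
`{v}`-units in congruence-depth form (`Chevalley1951.vUnits_valuation_sub_one_le`,
`ChevalleyVUnitCongruenceProofs.lean`).  This file proves the GENERAL statement, by Chevalley's own
argument and with the tree's inputs for the two special cases:

* `Literature.NumberTheory.NumberFields.Chevalley1951.thm1_holds : Chevalley1951.thm1`.

Theorems only: no `sorry`, no new definition, no new named fact (D-0026; net debt `-1`).

## The printed proof and its formalisation

* **§1 (p. 36–37), the saturation `E₀` of `E`.**  «Désignons par `E₀` l'ensemble des nombres `x ≠ 0`
  de `K` dont une puissance (d'exposant `b ≠ 0`) appartient à `E` … `E₀` est contenu dans le groupe des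
  `x ≠ 0` tels que l'idéal fractionnaire engendré par `x` soit un produit de puissances de
  `𝔭_1, …, 𝔭_h` [the primes of the generators].  Ce groupe étant à engendrement fini, il en sera de
  même de `E₀`.  Le groupe `E₀/E` est … fini; soit `n` son ordre … Remplaçant `m` par `mn`, on voit
  qu'il suffira de montrer l'existence d'un entier `a`, premier à `N`, tel que tout élément
  `≡ 1 (mod a)` de `E` soit puissance `m`-ième d'un NOMBRE DE `K`.»  Here: the generators of `E` have
  finite support, so `E ≤ S.unit K` for a finite set `S` of finite places
  (`Chevalley1951.exists_finset_closure_le_sUnit`); the `S`-units are finitely generated — the tree's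
  `S`-unit theorem `DiophantineGeometry.instModuleFinite_sUnit` (O'Meara 33:10), which is exactly
  Chevalley's «comme il est bien connu» — hence a Noetherian `ℤ`-module, so the saturation of `E` in
  it is finitely generated and there is an exponent `n₀ > 0` with `y^b ∈ E (b > 0) ⟹ y^{n₀} ∈ E`
  (`Chevalley1951.exists_saturation_exponent`).
* **§2 (p. 37), reduction to prime-power exponents** («`a` le p.p.c.m. des `a_i`»; here the product):
  `Chevalley1951.fg_exists_modulus_nat`, by `Nat.recOnPosPrimePosCoprime` and the tree's Bezout lemma
  `Chevalley1951.exists_torsion_mul_pow_of_coprime`.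
* **§5 (p. 39) with the Chebotarev argument of pp. 39–40, prime-power exponent `p^f`**
  (`Chevalley1951.fg_exists_modulus_primePow`): `n = p^{f+2}`, `L` the splitting field over `K` of
  `(X^n - 1) ∏_{g} (X^n - g)` over the generators `g` of `E` («`L` obtenu par adjonction à `K` des
  racines `m`-ièmes des nombres de `E`»), `ζ ∈ L` a primitive `n`-th root of unity; for each
  `σ ∈ Gal(L/K)` Chebotarev (the tree's `Chevalley1951.exists_prime_absNorm_isArithFrobAt_not_mem`)
  gives a prime `𝔮_σ` of `K` of prime norm `ℓ_σ ∤ pN` with `𝔔_σ ∣ 𝔮_σ` in `L` at which `σ` is a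
  Frobenius; `a = ∏_σ ℓ_σ`.  If `x ∈ E` and `x ≡ 1 (mod a)`, say `x - 1 = a y₀ / z` with `z` prime to
  `a`, then `x = x₁ / z` with `x₁ = z + a y₀ ≡ z (mod 𝔮_σ)` and `z ∉ 𝔮_σ`: «`x` est puissance `m`-ième
  dans la complétion `𝔮_σ`-adique de `K`», in the form that a Frobenius at `𝔔_σ ∤ n` fixing `ζ` fixes
  every `n`-th root of `x` (`Chevalley1951.smul_eq_self_of_isArithFrobAt_of_sub_pow_mem`, the
  computation of the tree's `smul_eq_self_of_isArithFrobAt'` for an integer `u ≡ c^n` instead of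
  `u ≡ 1`, applied to `u = x₁ z^{n-1}`, `c = z` and the integral `n`-th root `y z` of `u`).  So every
  `σ ∈ Gal(L/K(ζ))` fixes an `n`-th root `y` of `x`, `y ∈ K(ζ)`, and the weak Remarque of §4 (the
  tree's `Chevalley1951.exists_eq_pow_or_eq_neg_pow_of_mem_adjoin`) gives `x = ± w^{p^{f+1}}`,
  `w ∈ K`.
* **The closing step** (here as in the tree's `thm1_units_holds`, replacing Chevalley's §3 passage to
  `K(√-1)` and the exact Remarque by an auxiliary prime): choose a prime `ℓ₀` exceeding `N`, `#μ(K)`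
  and `D = ∏_{v ∈ S} N𝔭_v`, and a place `t₀ ∣ ℓ₀`; let `c₀ = #(𝓞_K/𝔭_{t₀})ˣ`; apply §2 with exponent
  `m n₀ c₀` and `N ℓ₀` to get `a₁`, and put `a = a₁ ℓ₀`.  If `x ∈ E`, `x ≡ 1 (mod a)`, then
  `x = ξ w^{m n₀ c₀}` with `ξ ∈ μ(K)`; `w` is an `S`-unit (a power of it lies in `E`), so
  `(w^{m n₀})^{c₀} ≡ 1 (mod t₀)` (`Chevalley1951.valuation_pow_card_sub_one_lt_one_of_mem_sUnit`: an
  `S`-unit is `u₁ / D^k` with `u₁ ∈ 𝓞_K` prime to `t₀`), and `x ≡ 1 (mod t₀)`, whence `ξ ≡ 1 (mod t₀)`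
  and `ξ = 1` (`Chevalley1951.eq_one_of_pow_eq_one_of_sub_one_mem`); finally `(w^{c₀})^{n₀} ∈ E` by
  the choice of `n₀`, and `x = ((w^{c₀})^{n₀})^m`.

## References

* C. Chevalley, *Deux théorèmes d'arithmétique*, J. Math. Soc. Japan 3 (1951) 36–44, Théorème 1
  (p. 36) and its proof §§1–5 (pp. 36–40). [ChevalleyDeuxTheoremes1951]
* O. T. O'Meara, *Introduction to quadratic forms*, Grundlehren 117 (1963), §33F Thm. 33:10 (the
  `S`-unit theorem). [Omeara1963]
* J. Tate, *Global class field theory*, Ch. VII of Cassels–Fröhlich (1967), §2.4 (Chebotarev).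
  [TateGCFT1967]
-/

noncomputable section

open NumberField IsDedekindDomain IsDedekindDomain.HeightOneSpectrum Polynomial

open scoped Classical IntermediateField NumberField

namespace Literature.NumberTheory.NumberFields

/-! ### §0. Hasse's multiplicative congruence `x ≡ 1 (mod a)`: `x - 1 = a y / z`, `z` prime to `a` -/

section Hasse

variable {K : Type*} [Field K] [NumberField K]

omit [NumberField K] in
/-- The denominator of a Hasse congruence `x ≡ 1 (mod a)` lies in no prime containing `a`.
[cite: ChevalleyDeuxTheoremes1951, Thm 1 (p. 36)] -/
theorem Chevalley1951.notMem_of_isCoprime_of_mem {t : HeightOneSpectrum (𝓞 K)} {z : 𝓞 K} {a : ℕ}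
    (hz : IsCoprime z (a : 𝓞 K)) (ha : (a : 𝓞 K) ∈ t.asIdeal) : z ∉ t.asIdeal := by
  intro hzt
  obtain ⟨r, s, hrs⟩ := hz
  have h1 : (1 : 𝓞 K) ∈ t.asIdeal := by
    rw [← hrs]
    exact t.asIdeal.add_mem (t.asIdeal.mul_mem_left r hzt) (t.asIdeal.mul_mem_left s ha)
  exact t.isPrime.ne_top ((Ideal.eq_top_iff_one _).mpr h1)

omit [NumberField K] in
/-- A Hasse congruence `x - 1 = a y / z` exhibits `x` as the quotient `(z + a y) / z` of two
algebraic integers. [cite: ChevalleyDeuxTheoremes1951, Thm 1 (p. 36)] -/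
theorem Chevalley1951.eq_div_of_sub_one_eq {x : K} {y z : 𝓞 K} {a : ℕ} (hz0 : (z : K) ≠ 0)
    (hx : x - 1 = (a : K) * (y : K) / (z : K)) :
    x = algebraMap (𝓞 K) K (z + a * y) / algebraMap (𝓞 K) K z := by
  have h1 : algebraMap (𝓞 K) K (z + a * y) = (z : K) + (a : K) * (y : K) := by push_cast; rfl
  have h2 : algebraMap (𝓞 K) K z = (z : K) := rfl
  have h3 : (x - 1) * (z : K) = (a : K) * (y : K) := by rw [hx]; field_simp
  rw [h1, h2, eq_div_iff hz0]
  linear_combination h3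

/-- Under a Hasse congruence `x ≡ 1 (mod a)`, `x ≡ 1` at every prime containing `a`:
`|x - 1|_t < 1`. [cite: ChevalleyDeuxTheoremes1951, Thm 1 (p. 36)] -/
theorem Chevalley1951.valuation_sub_one_lt_one_of_hasse {t : HeightOneSpectrum (𝓞 K)} {x : K}
    {y z : 𝓞 K} {a : ℕ} (hz : IsCoprime z (a : 𝓞 K))
    (hx : x - 1 = (a : K) * (y : K) / (z : K)) (ha : (a : 𝓞 K) ∈ t.asIdeal) :
    t.valuation K (x - 1) < 1 := by
  have hzt : z ∉ t.asIdeal := Chevalley1951.notMem_of_isCoprime_of_mem hz ha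
  have hvz : t.valuation K (z : K) = 1 :=
    (HeightOneSpectrum.valuation_eq_one_iff_notMem t).mpr hzt
  have hva : t.valuation K ((a : 𝓞 K) : K) < 1 :=
    (Chevalley1951.valuation_algebraMap_lt_one_iff t _).mpr ha
  have hvy : t.valuation K (y : K) ≤ 1 := HeightOneSpectrum.valuation_le_one t y
  rw [hx, map_div₀, map_mul, hvz, div_one]
  have hcast : ((a : 𝓞 K) : K) = (a : K) := by norm_cast
  rw [← hcast]
  calc t.valuation K ((a : 𝓞 K) : K) * t.valuation K (y : K)
      ≤ t.valuation K ((a : 𝓞 K) : K) := mul_le_of_le_one_right' hvy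
    _ < 1 := hva

/-- A Hasse congruence modulo `a` is a Hasse congruence modulo every divisor `a₁` of `a`.
[cite: ChevalleyDeuxTheoremes1951, §2 (p. 37)] -/
theorem Chevalley1951.hasse_of_dvd {x : K} {a a₁ : ℕ} (h : a₁ ∣ a)
    (hx : ∃ y z : 𝓞 K, (z : K) ≠ 0 ∧ IsCoprime z (a : 𝓞 K) ∧ x - 1 = (a : K) * (y : K) / (z : K)) :
    ∃ y z : 𝓞 K, (z : K) ≠ 0 ∧ IsCoprime z (a₁ : 𝓞 K) ∧ x - 1 = (a₁ : K) * (y : K) / (z : K) := by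
  obtain ⟨c, rfl⟩ := h
  obtain ⟨y, z, hz0, hz, hx⟩ := hx
  refine ⟨c * y, z, hz0, ?_, ?_⟩
  · rw [Nat.cast_mul] at hz
    exact hz.of_mul_right_left
  · rw [hx]
    push_cast
    ring

end Hasse

/-! ### §1a. The support of a finitely generated `E ≤ Kˣ`: `E ≤ S.unit K` for a finite `S` -/

section Support

variable {K : Type*} [Field K] [NumberField K]

/-- **Chevalley §1: a finitely generated `E ≤ Kˣ` consists of `S`-units for a finite set `S` of
finite places** («`E₀` est contenu dans le groupe des `x ≠ 0` tels que l'idéal fractionnaire engendré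
par `x` soit un produit de puissances de `𝔭_1, …, 𝔭_h`», the primes of the generators).
[cite: ChevalleyDeuxTheoremes1951, §1 (pp. 36–37)] -/
theorem Chevalley1951.exists_finset_closure_le_sUnit (s : Finset Kˣ) :
    ∃ S : Finset (HeightOneSpectrum (𝓞 K)),
      Subgroup.closure (s : Set Kˣ) ≤ (S : Set (HeightOneSpectrum (𝓞 K))).unit K := by
  -- the places where a given `g ∈ Kˣ` is not a unit form a finite set (the prime factors of a
  -- numerator and a denominator; as a standalone statement this is the tree's
  -- `GaloisRepresentations.IdelicCharacter.finite_setOf_valuation_ne_one`, not imported here)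
  have hg1 : ∀ g : Kˣ, {v : HeightOneSpectrum (𝓞 K) | v.valuation K (g : K) ≠ 1}.Finite := by
    intro g
    obtain ⟨a, b, hb, hab⟩ := IsFractionRing.div_surjective (A := 𝓞 K) (g : K)
    have hb0 : b ≠ 0 := nonZeroDivisors.ne_zero hb
    have ha0 : a ≠ 0 := by
      rintro rfl
      rw [map_zero, zero_div] at hab
      exact g.ne_zero hab.symm
    have hfa := Ideal.finite_factors (I := Ideal.span {a})
      (by rw [Ne, Ideal.zero_eq_bot, Ideal.span_singleton_eq_bot]; exact ha0)
    have hfb := Ideal.finite_factors (I := Ideal.span {b})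
      (by rw [Ne, Ideal.zero_eq_bot, Ideal.span_singleton_eq_bot]; exact hb0)
    refine (hfa.union hfb).subset fun v hv => ?_
    simp only [Set.mem_setOf_eq, Set.mem_union] at hv ⊢
    by_contra hcon
    obtain ⟨h1, h2⟩ := not_or.mp hcon
    have hva : v.valuation K (algebraMap (𝓞 K) K a) = 1 := by
      rw [HeightOneSpectrum.valuation_eq_one_iff_notMem]
      exact fun h => h1 (Ideal.dvd_span_singleton.mpr h)
    have hvb : v.valuation K (algebraMap (𝓞 K) K b) = 1 := by
      rw [HeightOneSpectrum.valuation_eq_one_iff_notMem]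
      exact fun h => h2 (Ideal.dvd_span_singleton.mpr h)
    apply hv
    rw [← hab, map_div₀, hva, hvb, div_one]
  have hfin : (⋃ g ∈ (s : Set Kˣ), {v : HeightOneSpectrum (𝓞 K) | v.valuation K (g : K) ≠ 1}).Finite :=
    s.finite_toSet.biUnion fun g _ => hg1 g
  refine ⟨hfin.toFinset, (Subgroup.closure_le _).mpr fun g hg v hv => ?_⟩
  by_contra hne
  apply hv
  rw [Set.Finite.coe_toFinset, Set.mem_iUnion₂]
  exact ⟨g, hg, hne⟩

/-- A root of an `S`-unit is an `S`-unit (the value groups `ℤ` are torsion free) — Chevalley §1: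
«`E₀` [the `x` with some `x^b ∈ E`] est contenu dans le groupe des `x ≠ 0` tels que l'idéal
fractionnaire engendré par `x` soit un produit de puissances de `𝔭_1, …, 𝔭_h`».
[cite: ChevalleyDeuxTheoremes1951, §1 (p. 37)] -/
theorem Chevalley1951.mem_sUnit_of_pow_mem {S : Set (HeightOneSpectrum (𝓞 K))} {y : Kˣ} {b : ℕ}
    (hb : 0 < b) (hy : y ^ b ∈ S.unit K) : y ∈ S.unit K := by
  intro v hv
  have h := hy v hv
  rw [Units.val_pow_eq_pow_val, map_pow] at h
  exact (pow_eq_one_iff_left hb.ne').mp h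

end Support

/-! ### §1b. `S`-units modulo an auxiliary prime: `u ≡ u₁ / D^k` with `u₁ ∈ 𝓞 K`, so `u^{#(𝓞/𝔭)ˣ} ≡ 1` -/

section Residue

variable {K : Type*} [Field K] [NumberField K]

/-- An `S`-unit becomes an algebraic integer after multiplication by a power of any natural number
`D` lying in all the primes of `S` (e.g. the product of their norms): `D^k u ∈ 𝓞 K`. [folklore] -/
private theorem Chevalley1951.exists_natCast_pow_mul_eq_algebraMap_of_mem_sUnit
    {S : Finset (HeightOneSpectrum (𝓞 K))} {D : ℕ} (hD : ∀ v ∈ S, (D : 𝓞 K) ∈ v.asIdeal) {u : Kˣ}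
    (hu : u ∈ (S : Set (HeightOneSpectrum (𝓞 K))).unit K) :
    ∃ (k : ℕ) (u₁ : 𝓞 K), algebraMap (𝓞 K) K u₁ = (D : K) ^ k * (u : K) := by
  -- the exponent `k = ∑_{v ∈ S} (log |u|_v)⁺`
  set e : HeightOneSpectrum (𝓞 K) → ℤ := fun v => WithZero.log (v.valuation K (u : K)) with hedef
  set k : ℕ := ∑ v ∈ S, (e v).toNat with hkdef
  have hval : ∀ v : HeightOneSpectrum (𝓞 K), v.valuation K ((D : K) ^ k * (u : K)) ≤ 1 := by
    intro v
    have hu0 : v.valuation K (u : K) ≠ 0 := (Valuation.ne_zero_iff _).mpr u.ne_zero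
    have hDk : ((D : K)) ^ k = algebraMap (𝓞 K) K (((D : 𝓞 K)) ^ k) := by push_cast; rfl
    by_cases hv : v ∈ S
    · -- `|D^k|_v ≤ q_v^{-k}` and `|u|_v = q_v^{e_v}` with `e_v ≤ k`
      have h1 : v.valuation K ((D : K) ^ k) ≤ WithZero.exp (-(k : ℤ)) := by
        rw [hDk, HeightOneSpectrum.valuation_of_algebraMap]
        exact (v.intValuation_le_pow_iff_mem _ k).mpr (Ideal.pow_mem_pow (hD v hv) k)
      have h2 : v.valuation K (u : K) = WithZero.exp (e v) := by
        rw [hedef]; exact (WithZero.exp_log hu0).symm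
      have h3 : e v ≤ k := by
        have h4 : (e v).toNat ≤ k := by
          rw [hkdef]
          exact Finset.single_le_sum (f := fun w => (e w).toNat) (fun w _ => Nat.zero_le _) hv
        have h5 : e v ≤ (e v).toNat := Int.self_le_toNat (e v)
        omega
      rw [map_mul, h2]
      calc v.valuation K ((D : K) ^ k) * WithZero.exp (e v)
          ≤ WithZero.exp (-(k : ℤ)) * WithZero.exp (e v) := mul_le_mul' h1 le_rfl
        _ = WithZero.exp (-(k : ℤ) + e v) := (WithZero.exp_add _ _).symm
        _ ≤ WithZero.exp 0 := WithZero.exp_le_exp.mpr (by omega)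
        _ = 1 := WithZero.exp_zero
    · rw [map_mul, hu v hv, mul_one, hDk]
      exact HeightOneSpectrum.valuation_le_one v _
  obtain ⟨u₁, hu₁⟩ := Chevalley1951.exists_ringOfIntegers_eq_of_valuation_le_one hval
  exact ⟨k, u₁, hu₁⟩

/-- **`S`-units are `≡` units modulo a prime off `S`**: if `t₀` is a finite place not containing
the natural number `D ∈ ⋂_{v ∈ S} 𝔭_v` and `u` is an `S`-unit, then `u^{c₀} ≡ 1 (mod 𝔭_{t₀})` for
`c₀ = #(𝓞 K/𝔭_{t₀})ˣ`, i.e. `|u^{c₀} - 1|_{t₀} < 1` (write `u = u₁ / D^k` with `u₁ ∈ 𝓞 K`; both `u₁`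
and `D^k` are prime to `𝔭_{t₀}`).  The step «`w^{c₀} ≡ 1 (mod ℓ₀)`» of the closing argument of
`Chevalley1951.thm1_units_holds`, for non-integral elements. [folklore] -/
private theorem Chevalley1951.valuation_pow_card_sub_one_lt_one_of_mem_sUnit
    {S : Finset (HeightOneSpectrum (𝓞 K))} {D : ℕ} (hD : ∀ v ∈ S, (D : 𝓞 K) ∈ v.asIdeal)
    {t₀ : HeightOneSpectrum (𝓞 K)} (hDt : (D : 𝓞 K) ∉ t₀.asIdeal) {u : Kˣ}
    (hu : u ∈ (S : Set (HeightOneSpectrum (𝓞 K))).unit K) :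
    t₀.valuation K ((u : K) ^ Nat.card (𝓞 K ⧸ t₀.asIdeal)ˣ - 1) < 1 := by
  haveI : Finite (𝓞 K ⧸ t₀.asIdeal) := Ideal.finiteQuotientOfFreeOfNeBot _ t₀.ne_bot
  set c : ℕ := Nat.card (𝓞 K ⧸ t₀.asIdeal)ˣ with hcdef
  obtain ⟨k, u₁, hu₁⟩ := Chevalley1951.exists_natCast_pow_mul_eq_algebraMap_of_mem_sUnit hD hu
  have ht₀S : t₀ ∉ S := fun h => hDt (hD t₀ h)
  obtain ⟨d, hddef⟩ : ∃ d : 𝓞 K, d = (D : 𝓞 K) ^ k := ⟨_, rfl⟩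
  have hdK : algebraMap (𝓞 K) K d = (D : K) ^ k := by rw [hddef]; push_cast; rfl
  have hdt : d ∉ t₀.asIdeal := fun h => hDt (t₀.isPrime.mem_of_pow_mem k (hddef ▸ h))
  have hvd : t₀.valuation K (algebraMap (𝓞 K) K d) = 1 :=
    (HeightOneSpectrum.valuation_eq_one_iff_notMem t₀).mpr hdt
  have hd0 : algebraMap (𝓞 K) K d ≠ 0 := by
    intro h; rw [h, map_zero] at hvd; exact zero_ne_one hvd
  -- `u₁` is prime to `t₀`
  have hvu₁ : t₀.valuation K (algebraMap (𝓞 K) K u₁) = 1 := by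
    rw [hu₁, map_mul, ← hdK, hvd, one_mul]
    exact hu t₀ (by exact_mod_cast ht₀S)
  have hu₁t : u₁ ∉ t₀.asIdeal := (HeightOneSpectrum.valuation_eq_one_iff_notMem t₀).mp hvu₁
  -- `u₁^c ≡ 1 ≡ d^c (mod t₀)`
  have h1 : u₁ ^ c - 1 ∈ t₀.asIdeal :=
    Chevalley1951.pow_card_units_sub_one_mem t₀.asIdeal (Chevalley1951.isUnit_mk_of_notMem t₀ hu₁t)
  have h2 : d ^ c - 1 ∈ t₀.asIdeal :=
    Chevalley1951.pow_card_units_sub_one_mem t₀.asIdeal (Chevalley1951.isUnit_mk_of_notMem t₀ hdt)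
  have h3 : u₁ ^ c - d ^ c ∈ t₀.asIdeal := by
    have h4 := t₀.asIdeal.sub_mem h1 h2
    rwa [sub_sub_sub_cancel_right] at h4
  have hdct : d ^ c ∉ t₀.asIdeal := fun h => hdt (t₀.isPrime.mem_of_pow_mem c h)
  -- `u^c - 1 = (u₁^c - d^c) / d^c`
  have hueq : (u : K) = algebraMap (𝓞 K) K u₁ / algebraMap (𝓞 K) K d := by
    rw [eq_div_iff hd0, hu₁, hdK, mul_comm]
  have hpow : (u : K) ^ c - 1 =
      algebraMap (𝓞 K) K (u₁ ^ c - d ^ c) / algebraMap (𝓞 K) K (d ^ c) := by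
    rw [hueq, map_sub, map_pow, map_pow]
    field_simp
    rw [div_pow, sub_mul, one_mul, div_mul_cancel₀ _ (pow_ne_zero _ hd0)]
  rw [hpow, map_div₀, (HeightOneSpectrum.valuation_eq_one_iff_notMem t₀).mpr hdct, div_one]
  exact (Chevalley1951.valuation_algebraMap_lt_one_iff t₀ _).mpr h3

/-- **An auxiliary prime**: for every bound `B` there are a rational prime `ℓ > B` and a finite place
`t` of `K` above `ℓ`; no rational integer `0 < m ≤ B` lies in `𝔭_t` (the rational integers in `𝔭_t`
are the multiples of `ℓ`).  (The auxiliary prime `ℓ₀ ∤ N · #μ(K)` of the tree's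
`Chevalley1951.thm1_units_holds`, here also avoiding the support of `E`.) [folklore] -/
private theorem Chevalley1951.exists_prime_gt_mem_place (B : ℕ) :
    ∃ (ℓ : ℕ) (t : HeightOneSpectrum (𝓞 K)), ℓ.Prime ∧ B < ℓ ∧ (ℓ : 𝓞 K) ∈ t.asIdeal ∧
      ∀ m : ℕ, 0 < m → m ≤ B → (m : 𝓞 K) ∉ t.asIdeal := by
  obtain ⟨ℓ, hℓle, hℓ⟩ := Nat.exists_infinite_primes (B + 1)
  have hmax : (Ideal.span {(ℓ : ℤ)}).IsMaximal :=
    ((Ideal.span_singleton_prime (by exact_mod_cast hℓ.ne_zero)).mpr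
      (Nat.prime_iff_prime_int.mp hℓ)).isMaximal (by simpa using hℓ.ne_zero)
  haveI := hmax
  obtain ⟨Q, hQmax, hQover⟩ :=
    Ideal.exists_maximal_ideal_liesOver_of_isIntegral (S := 𝓞 K) (Ideal.span {(ℓ : ℤ)})
  have hQbot : Q ≠ ⊥ :=
    Ring.ne_bot_of_isMaximal_of_not_isField hQmax (RingOfIntegers.not_isField K)
  have hdvd : ∀ m : ℕ, (m : 𝓞 K) ∈ Q → ℓ ∣ m := by
    intro m hm
    have h1 : (m : ℤ) ∈ Q.under ℤ := by
      rw [Ideal.under, Ideal.mem_comap, map_natCast]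
      exact hm
    rw [← hQover.over, Ideal.mem_span_singleton] at h1
    exact Int.natCast_dvd_natCast.mp h1
  have hℓQ : (ℓ : 𝓞 K) ∈ Q := by
    have h1 : (ℓ : ℤ) ∈ Q.under ℤ := by
      rw [← hQover.over]; exact Ideal.mem_span_singleton_self _
    rw [Ideal.under, Ideal.mem_comap, map_natCast] at h1
    exact h1
  refine ⟨ℓ, ⟨Q, hQmax.isPrime, hQbot⟩, hℓ, by omega, hℓQ, fun m hm hmB hmem => ?_⟩
  have h1 : ℓ ≤ m := Nat.le_of_dvd hm (hdvd m hmem)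
  omega

end Residue

/-! ### §2. A Frobenius at `𝔔 ∤ n` fixing `μ_n` fixes the `n`-th roots of integers `≡ c^n (mod 𝔔)` -/

section Frobenius

variable {K L : Type*} [Field K] [Field L] [Algebra K L]

/-- **Variant of the tree's `Chevalley1951.smul_eq_self_of_isArithFrobAt'` for an integer `u`
congruent to an `n`-th POWER `c^n` modulo `𝔔`** (instead of `u ≡ 1`): if `σ` is an arithmetic
Frobenius at the prime `𝔔 ∤ n` of `𝓞 L` fixing a primitive `n`-th root of unity `ζ ∈ 𝓞 L`, and
`u, c ∈ 𝓞 K` with `c ∉ 𝔔`, `u ≡ c^n (mod 𝔔 ∩ 𝓞 K)`, then `σ` fixes every `y ∈ 𝓞 L` with `y^n = u`.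
Computation (Chevalley 1951, §5, p. 39, «`x` est puissance `m`-ième dans la complétion `𝔮_j`-adique
de `K`»): `n ∣ N𝔮 - 1 = nk`; `c^{N𝔮 - 1} ≡ 1`, so `u^k ≡ c^{nk} ≡ 1`; `σ y ≡ y^{N𝔮} = y u^k ≡ y`,
`σ y = ζ^i y`, so `ζ^i ≡ 1 (mod 𝔔)` and `ζ^i = 1`.  Used with `u = x₁ z^{n-1}`, `c = z` for a Hasse
congruence `x = x₁ / z`, `x₁ ≡ z`. [cite: ChevalleyDeuxTheoremes1951, §5 (p. 39)] -/
theorem Chevalley1951.smul_eq_self_of_isArithFrobAt_of_sub_pow_mem (Q : Ideal (𝓞 L)) [Q.IsPrime]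
    {σ : L ≃ₐ[K] L} (hσ : IsArithFrobAt (𝓞 K) σ Q) {n : ℕ} (hn : (n : 𝓞 L) ∉ Q) {ζ : 𝓞 L}
    (hζ : IsPrimitiveRoot ζ n) (hσζ : σ • ζ = ζ) (u c : 𝓞 K) (hc : c ∉ Q.under (𝓞 K))
    (huc : u - c ^ n ∈ Q.under (𝓞 K)) {y : 𝓞 L}
    (hy : y ^ n = algebraMap (𝓞 K) (𝓞 L) u) : σ • y = y := by
  set q := Nat.card (𝓞 K ⧸ Q.under (𝓞 K)) with hqdef
  have hn0 : n ≠ 0 := by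
    rintro rfl
    exact hn (by rw [Nat.cast_zero]; exact Q.zero_mem)
  haveI : NeZero n := ⟨hn0⟩
  -- `σ ζ = ζ ^ q = ζ`, so `n ∣ q - 1`
  have hζq : ζ ^ q = ζ := by
    have h := hσ.apply_of_pow_eq_one hζ.pow_eq_one hn
    rw [MulSemiringAction.toAlgHom_apply, hσζ] at h
    exact h.symm
  have hq1 : 1 ≤ q := hσ.card_pos
  have hndvd : n ∣ q - 1 := by
    rw [← hζ.pow_eq_one_iff_dvd]
    have hζ0 : ζ ≠ 0 := hζ.ne_zero hn0
    have h2 : ζ ^ (q - 1) * ζ = 1 * ζ := by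
      rw [← pow_succ, Nat.sub_add_cancel hq1, hζq, one_mul]
    exact mul_right_cancel₀ hζ0 h2
  obtain ⟨k, hk⟩ := hndvd
  -- the images `u', c'` of `u, c` in `𝓞 L`
  set u' : 𝓞 L := algebraMap (𝓞 K) (𝓞 L) u with hu'def
  set c' : 𝓞 L := algebraMap (𝓞 K) (𝓞 L) c with hc'def
  have hc'Q : c' ∉ Q := fun h => hc (Ideal.mem_comap.mpr h)
  have hucQ : u' - c' ^ n ∈ Q := by
    have h := Ideal.mem_comap.mp huc
    rwa [map_sub, map_pow] at h
  have hu'Q : u' ∉ Q := by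
    intro h
    have h1 : c' ^ n ∈ Q := by
      have h2 := Q.sub_mem h hucQ
      rwa [sub_sub_cancel] at h2
    exact hc'Q (Ideal.IsPrime.mem_of_pow_mem ‹_› n h1)
  -- Fermat: `c' ^ (q - 1) ≡ 1 (mod 𝔔)` (`σ c' = c'` and `σ c' ≡ c' ^ q`)
  have hcq : c' ^ (q - 1) - 1 ∈ Q := by
    have h1 := hσ c'
    rw [MulSemiringAction.toAlgHom_apply, hc'def, Chevalley1951.smul_algebraMap_ringOfIntegers,
      ← hc'def] at h1
    -- `c' - c'^q = -(c' * (c'^(q-1) - 1))`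
    have h2 : c' * (c' ^ (q - 1) - 1) ∈ Q := by
      have h3 : c' * (c' ^ (q - 1) - 1) = -(c' - c' ^ q) := by
        rw [mul_sub, mul_one, ← pow_succ', Nat.sub_add_cancel hq1]; ring
      rw [h3]; exact Q.neg_mem h1
    exact (Ideal.IsPrime.mem_or_mem ‹_› h2).resolve_left hc'Q
  -- `u' ^ k ≡ c' ^ (n k) = c' ^ (q - 1) ≡ 1 (mod 𝔔)`
  have hukQ : u' ^ k - 1 ∈ Q := by
    have h1 : u' ^ k - (c' ^ n) ^ k ∈ Q :=
      Ideal.mem_of_dvd _ (sub_dvd_pow_sub_pow u' (c' ^ n) k) hucQ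
    have h2 : (c' ^ n) ^ k - 1 ∈ Q := by rwa [← pow_mul, ← hk]
    have h3 := Q.add_mem h1 h2
    rwa [sub_add_sub_cancel] at h3
  -- `y ^ q - y ∈ 𝔔`
  have hyq : y ^ q - y ∈ Q := by
    have h1 : y ^ q = y * u' ^ k := by
      rw [← hy, ← pow_mul, ← hk, ← pow_succ', Nat.sub_add_cancel hq1]
    rw [h1, ← mul_sub_one]
    exact Q.mul_mem_left y hukQ
  -- hence `σ y - y ∈ 𝔔`
  have hσy : σ • y - y ∈ Q := by
    have h1 := hσ y
    rw [MulSemiringAction.toAlgHom_apply] at h1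
    have h2 := Q.add_mem h1 hyq
    rwa [sub_add_sub_cancel] at h2
  -- `y ∉ 𝔔`
  have hyQ : y ∉ Q := fun h => hu'Q (by rw [← hy]; exact Q.pow_mem_of_mem h n (Nat.pos_of_ne_zero hn0))
  -- `σ y = ζ^i y` with `(ζ^i)^n = 1`, computed in `L`
  set yL : L := algebraMap (𝓞 L) L y with hyLdef
  have hy0 : yL ≠ 0 := by
    rw [hyLdef, Ne, RingOfIntegers.coe_eq_zero_iff]
    rintro rfl
    exact hyQ Q.zero_mem
  have hζL : IsPrimitiveRoot (algebraMap (𝓞 L) L ζ) n :=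
    hζ.map_of_injective RingOfIntegers.coe_injective
  have hcoe : ∀ z : 𝓞 L, algebraMap (𝓞 L) L (σ • z) = σ (algebraMap (𝓞 L) L z) := fun z => rfl
  have hηn : (σ yL * yL⁻¹) ^ n = 1 := by
    have h1 : σ (yL ^ n) = yL ^ n := by
      have h2 : yL ^ n = algebraMap K L (algebraMap (𝓞 K) K u) := by
        rw [hyLdef, ← map_pow, hy, ← IsScalarTower.algebraMap_apply (𝓞 K) (𝓞 L) L,
          IsScalarTower.algebraMap_apply (𝓞 K) K L]
      rw [h2, AlgEquiv.commutes]
    rw [mul_pow, ← map_pow, h1, inv_pow, mul_inv_cancel₀ (pow_ne_zero _ hy0)]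
  obtain ⟨i, -, hi⟩ := hζL.eq_pow_of_pow_eq_one hηn
  have hσyL : σ yL = algebraMap (𝓞 L) L ζ ^ i * yL := by
    rw [hi, inv_mul_cancel_right₀ hy0]
  have hσy' : σ • y = ζ ^ i * y := by
    apply RingOfIntegers.coe_injective
    rw [hcoe, map_mul, map_pow]
    exact hσyL
  -- `ζ^i ≡ 1 (mod 𝔔)`, hence `ζ^i = 1`
  have h1 : ζ ^ i - 1 ∈ Q := by
    have h2 : (ζ ^ i - 1) * y ∈ Q := by rw [sub_mul, one_mul, ← hσy']; exact hσy
    exact (Ideal.IsPrime.mem_or_mem ‹_› h2).resolve_right hyQ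
  have hζi : ζ ^ i = 1 :=
    Chevalley1951.eq_one_of_pow_eq_one_of_sub_one_mem Q hn
      (by rw [← pow_mul, mul_comm, pow_mul, hζ.pow_eq_one, one_pow]) h1
  rw [hσy', hζi, one_mul]

end Frobenius

/-! ### §1c. Chevalley §1: the saturation of `E` in the `S`-units has finite exponent over `E` -/

section Saturation

variable {K : Type*} [Field K] [NumberField K]

/-- **Chevalley §1, «le groupe `E₀/E` est un groupe à engendrement fini dont tous les éléments sont
d'ordres finis; c'est donc un groupe fini; soit `n` son ordre»**, in exponent form: for a subgroup
`E` of the `S`-units (`S` finite) there is `n₀ > 0` such that every `y ∈ Kˣ` some power `y^b`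
(`b > 0`) of which lies in `E` satisfies `y^{n₀} ∈ E`.  Proof: such a `y` is an `S`-unit; the
`S`-units are a finitely generated abelian group (the tree's `S`-unit theorem
`DiophantineGeometry.instModuleFinite_sUnit` — Chevalley's «comme il est bien connu»), hence a
Noetherian `ℤ`-module, so the saturation `{y : ∃ b > 0, y^b ∈ E}` is generated by finitely many
`y_i` with `y_i^{b_i} ∈ E`, and `n₀ = ∏ b_i` works. [cite: ChevalleyDeuxTheoremes1951, §1 (pp. 36–37)] -/
theorem Chevalley1951.exists_saturation_exponent (S : Finset (HeightOneSpectrum (𝓞 K)))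
    {E : Subgroup Kˣ} (hE : E ≤ (S : Set (HeightOneSpectrum (𝓞 K))).unit K) :
    ∃ n₀ : ℕ, 0 < n₀ ∧ ∀ (y : Kˣ) (b : ℕ), 0 < b → y ^ b ∈ E → y ^ n₀ ∈ E := by
  haveI : Finite (S : Set (HeightOneSpectrum (𝓞 K))) := S.finite_toSet.to_subtype
  set U : Subgroup Kˣ := (S : Set (HeightOneSpectrum (𝓞 K))).unit K with hUdef
  haveI : IsNoetherian ℤ (Additive U) := isNoetherian_of_isNoetherianRing_of_finite ℤ _
  -- the saturation of `E` in the `S`-units, as a `ℤ`-submodule of the additive group of `S`-units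
  -- (membership is spelled multiplicatively, in `Kˣ`)
  let sat : Submodule ℤ (Additive U) :=
    { carrier := {y | ∃ b : ℕ, 0 < b ∧ ((Additive.toMul y : U) : Kˣ) ^ b ∈ E}
      add_mem' := fun {y₁ y₂} h₁ h₂ => by
        obtain ⟨b₁, hb₁, h₁⟩ := h₁
        obtain ⟨b₂, hb₂, h₂⟩ := h₂
        refine ⟨b₁ * b₂, Nat.mul_pos hb₁ hb₂, ?_⟩
        rw [toMul_add, Subgroup.coe_mul, mul_pow, pow_mul, mul_comm b₁ b₂, pow_mul]
        exact E.mul_mem (E.pow_mem h₁ b₂) (E.pow_mem h₂ b₁)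
      zero_mem' := ⟨1, one_pos, by rw [toMul_zero, Subgroup.coe_one, one_pow]; exact E.one_mem⟩
      smul_mem' := fun c y hy => by
        obtain ⟨b, hb, h⟩ := hy
        refine ⟨b, hb, ?_⟩
        rw [toMul_zsmul, Subgroup.coe_zpow, ← zpow_natCast, ← zpow_mul, mul_comm, zpow_mul,
          zpow_natCast]
        exact E.zpow_mem h c }
  have hsatmem : ∀ y : Additive U,
      y ∈ sat ↔ ∃ b : ℕ, 0 < b ∧ ((Additive.toMul y : U) : Kˣ) ^ b ∈ E := fun y => Iff.rfl
  -- the saturation is finitely generated: generators `g ∈ t` with `g^{b_g} ∈ E`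
  obtain ⟨t, ht⟩ : sat.FG := IsNoetherian.noetherian sat
  have hw : ∀ g ∈ t, ∃ b : ℕ, 0 < b ∧ ((Additive.toMul g : U) : Kˣ) ^ b ∈ E := fun g hg => by
    rw [← hsatmem, ← ht]
    exact Submodule.subset_span hg
  choose! b hb hbE using hw
  set n₀ : ℕ := ∏ g ∈ t, b g with hn₀def
  have hn₀ : 0 < n₀ := Finset.prod_pos fun g hg => hb g hg
  -- `n₀`-th powers of the saturation lie in `E`
  have hkill : ∀ y ∈ sat, ((Additive.toMul y : U) : Kˣ) ^ n₀ ∈ E := by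
    intro y hy
    rw [← ht] at hy
    induction hy using Submodule.span_induction with
    | mem g hg =>
      obtain ⟨c, hc⟩ : b g ∣ n₀ := Finset.dvd_prod_of_mem b hg
      rw [hc, pow_mul]
      exact E.pow_mem (hbE g hg) c
    | zero => rw [toMul_zero, Subgroup.coe_one, one_pow]; exact E.one_mem
    | add x y _ _ hx hy => rw [toMul_add, Subgroup.coe_mul, mul_pow]; exact E.mul_mem hx hy
    | smul a x _ hx =>
      rw [toMul_zsmul, Subgroup.coe_zpow, ← zpow_natCast, ← zpow_mul, mul_comm, zpow_mul,
        zpow_natCast]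
      exact E.zpow_mem hx a
  refine ⟨n₀, hn₀, fun y c hc hyc => ?_⟩
  -- `y` is an `S`-unit, and `ofMul y` lies in the saturation
  have hyU : y ∈ U := Chevalley1951.mem_sUnit_of_pow_mem hc (hE hyc)
  have hYsat : Additive.ofMul (⟨y, hyU⟩ : U) ∈ sat := by
    rw [hsatmem]
    exact ⟨c, hc, by rw [toMul_ofMul]; exact hyc⟩
  have h := hkill _ hYsat
  rwa [toMul_ofMul] at h

end Saturation

/-! ### §3. Step 1: prime-power exponents, for a finitely generated `E`, modulo roots of unity
(Chevalley §5 and pp. 39–40) -/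

section PrimePow

variable {K : Type} [Field K] [NumberField K]

/-- **Chevalley's Théorème 1 for `E = ⟨s⟩`, prime-power exponent, modulo roots of unity, at the level
of `K`** (§5, p. 39, with the Chebotarev argument of pp. 39–40 and the weak Remarque of §4; the
argument of the tree's `Chevalley1951.exists_modulus_primePow` / `vUnits_exists_places_primePow` for
an arbitrary finite set `s ⊆ Kˣ` of generators): for a prime `p`, `f ≥ 0` and `N > 0` there is `a > 0`
prime to `N` such that every `x ∈ ⟨s⟩` with `x ≡ 1 (mod a)` in Hasse's sense (`x - 1 = a y / z`, `z`
prime to `a`) lies in `μ(K) · (Kˣ)^{p^f}` (indeed `x = ± w^{p^{f+1}}`).  Proof: `n = p^{f+2}`, `L` the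
splitting field of `(X^n - 1) ∏_{g ∈ s} (X^n - g)`, `ζ ∈ L` a primitive `n`-th root of unity; for each
`σ ∈ Gal(L/K)` a prime `𝔮_σ ∌ pN` of prime norm `ℓ_σ` with `𝔔_σ ∣ 𝔮_σ` in `L` at which `σ` is a
Frobenius (Chebotarev); `a = ∏_σ ℓ_σ`; if `x - 1 = a y₀ / z` then `x = x₁ / z`, `x₁ = z + a y₀ ≡ z`,
`z ∉ 𝔮_σ`, and every `σ ∈ Gal(L/K(ζ))` fixes the integral `n`-th root `y z` of `x₁ z^{n-1} ≡ z^n`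
(`smul_eq_self_of_isArithFrobAt_of_sub_pow_mem`), hence the `n`-th root `y` of `x`; so `y ∈ K(ζ)` and
`x = ± w^{p^{f+1}}`. [cite: ChevalleyDeuxTheoremes1951, Thm 1, §5 (p. 39) and pp. 39–40] -/
theorem Chevalley1951.fg_exists_modulus_primePow (s : Finset Kˣ) {p : ℕ} (hp : p.Prime) (f : ℕ)
    {N : ℕ} (hN : 0 < N) :
    ∃ a : ℕ, 0 < a ∧ Nat.Coprime a N ∧
      ∀ x : Kˣ, x ∈ Subgroup.closure (s : Set Kˣ) →
        (∃ y z : 𝓞 K, (z : K) ≠ 0 ∧ IsCoprime z (a : 𝓞 K) ∧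
            (x : K) - 1 = (a : K) * (y : K) / (z : K)) →
          ∃ (w ξ : Kˣ), ξ ∈ CommGroup.torsion Kˣ ∧ (x : K) = (ξ : K) * (w : K) ^ p ^ f := by
  -- the exponent `n = p^t`, `t = f + 2`
  set t : ℕ := f + 2 with htdef
  set n : ℕ := p ^ t with hndef
  have hp0 : p ≠ 0 := hp.ne_zero
  have hn : 0 < n := pow_pos hp.pos t
  haveI : NeZero n := ⟨hn.ne'⟩
  -- the polynomial `(X^n - 1) ∏_{g ∈ s} (X^n - g)` and its splitting field
  set P : K[X] := (X ^ n - 1) * ∏ g ∈ s, (X ^ n - C ((g : Kˣ) : K)) with hPdef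
  have hXn1 : (X ^ n - 1 : K[X]) ≠ 0 := by
    rw [← C_1]; exact X_pow_sub_C_ne_zero hn 1
  have hXnC : ∀ c : K, (X ^ n - C c : K[X]) ≠ 0 := fun c => X_pow_sub_C_ne_zero hn c
  have hP0 : P ≠ 0 := by
    rw [hPdef]
    exact mul_ne_zero hXn1 (Finset.prod_ne_zero_iff.mpr fun g _ => hXnC _)
  let L := P.SplittingField
  haveI : NumberField L := NumberField.of_module_finite K L
  haveI : PerfectField K := PerfectField.ofCharZero
  haveI : IsGalois K L := isGalois_iff.mpr ⟨inferInstance, inferInstance⟩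
  haveI : Fintype (L ≃ₐ[K] L) := Fintype.ofFinite _
  have hsplit : (P.map (algebraMap K L)).Splits := SplittingField.splits P
  -- a primitive `n`-th root of unity `ζ ∈ L`
  obtain ⟨ζ, hζ⟩ : ∃ ζ : L, IsPrimitiveRoot ζ n := by
    have hdvd : Polynomial.cyclotomic n K ∣ P := by
      rw [hPdef]
      exact (Polynomial.cyclotomic.dvd_X_pow_sub_one n K).trans (dvd_mul_right _ _)
    have hdvd' : Polynomial.cyclotomic n L ∣ P.map (algebraMap K L) := by
      rw [← Polynomial.map_cyclotomic n (algebraMap K L)]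
      exact Polynomial.map_dvd _ hdvd
    have hspl : (Polynomial.cyclotomic n L).Splits :=
      hsplit.of_dvd (Polynomial.map_ne_zero hP0) hdvd'
    have hdeg : (Polynomial.cyclotomic n L).degree ≠ 0 := by
      rw [Polynomial.degree_cyclotomic]
      exact_mod_cast (Nat.totient_pos.mpr hn).ne'
    obtain ⟨ζ, hζ⟩ := hspl.exists_eval_eq_zero hdeg
    exact ⟨ζ, (Polynomial.isRoot_cyclotomic_iff_charZero hn).mp hζ⟩
  -- `n`-th roots in `Lˣ` of the generators, hence of every element of `⟨s⟩`
  set φ : Kˣ →* Lˣ := Units.map (algebraMap K L : K →* L) with hφdef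
  have hφval : ∀ g : Kˣ, ((φ g : Lˣ) : L) = algebraMap K L (g : K) := fun g => rfl
  have hrootg : ∀ g ∈ s, ∃ Y : Lˣ, Y ^ n = φ g := by
    intro g hg
    have hdvd : (X ^ n - C (g : K)) ∣ P := by
      rw [hPdef]
      exact (Finset.dvd_prod_of_mem (fun g : Kˣ => (X ^ n - C ((g : Kˣ) : K) : K[X])) hg).trans
        (dvd_mul_left _ _)
    obtain ⟨y, hy⟩ := Chevalley1951.exists_pow_eq_of_dvd_of_splits hP0 hsplit hn hdvd
    have hy0 : y ≠ 0 := by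
      rintro rfl
      rw [zero_pow hn.ne'] at hy
      exact (map_ne_zero (algebraMap K L)).mpr g.ne_zero hy.symm
    exact ⟨Units.mk0 y hy0, Units.ext (by rw [Units.val_pow_eq_pow_val, Units.val_mk0, hy, hφval])⟩
  have hrootx : ∀ x ∈ Subgroup.closure (s : Set Kˣ), ∃ Y : Lˣ, Y ^ n = φ x := by
    have hle : Subgroup.closure (s : Set Kˣ) ≤ ((powMonoidHom n : Lˣ →* Lˣ).range).comap φ := by
      rw [Subgroup.closure_le]
      intro g hg
      obtain ⟨Y, hY⟩ := hrootg g hg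
      rw [SetLike.mem_coe, Subgroup.mem_comap, MonoidHom.mem_range]
      exact ⟨Y, hY⟩
    intro x hx
    have h := hle hx
    rw [Subgroup.mem_comap, MonoidHom.mem_range] at h
    exact h
  -- the field `K' = K(ζ)` and the group `H = Gal(L/K')`
  set K' : IntermediateField K L := K⟮ζ⟯ with hK'def
  set H : Subgroup (L ≃ₐ[K] L) := K'.fixingSubgroup with hHdef
  -- the finite set of places to avoid: those containing `p N`
  set S' : Set (HeightOneSpectrum (𝓞 K)) := {u | ((p * N : ℕ) : 𝓞 K) ∈ u.asIdeal} with hS'def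
  have hpN0 : ((p * N : ℕ) : 𝓞 K) ≠ 0 := by exact_mod_cast (Nat.mul_pos hp.pos hN).ne'
  have hS'fin : S'.Finite := by
    refine (Ideal.finite_factors (I := Ideal.span {((p * N : ℕ) : 𝓞 K)})
      (by rw [Ne, Ideal.zero_eq_bot, Ideal.span_singleton_eq_bot]; exact hpN0)).subset ?_
    intro u hu
    exact (Ideal.dvd_span_singleton).mpr hu
  -- Chebotarev: for each `σ` a good place `vσ σ` of prime norm and a prime `Q σ` of `𝓞 L` above it
  have hcheb := fun σ : L ≃ₐ[K] L =>
    Chevalley1951.exists_prime_absNorm_isArithFrobAt_not_mem σ hS'fin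
  choose vσ hvS hvprime Q hQ hfrob using hcheb
  -- the primes `ℓ_σ = N𝔮_σ`
  set ℓ : (L ≃ₐ[K] L) → ℕ := fun σ => Ideal.absNorm (vσ σ).asIdeal with hℓdef
  have hℓmem : ∀ σ, (ℓ σ : 𝓞 K) ∈ (vσ σ).asIdeal := fun σ => Ideal.absNorm_mem _
  have hℓN : ∀ σ, Nat.Coprime (ℓ σ) N := by
    intro σ
    rw [Nat.Prime.coprime_iff_not_dvd (hvprime σ)]
    rintro ⟨c, hc⟩
    apply hvS σ
    change ((p * N : ℕ) : 𝓞 K) ∈ (vσ σ).asIdeal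
    rw [hc, Nat.cast_mul, Nat.cast_mul, mul_left_comm]
    exact Ideal.mul_mem_right _ _ (hℓmem σ)
  have hpQ : ∀ σ, (n : 𝓞 L) ∉ Q σ := by
    intro σ hmem
    apply hvS σ
    change ((p * N : ℕ) : 𝓞 K) ∈ (vσ σ).asIdeal
    haveI := (hQ σ).1
    have h1 : (p : 𝓞 L) ∈ Q σ := by
      rw [hndef, Nat.cast_pow] at hmem
      exact Ideal.IsPrime.mem_of_pow_mem ‹_› t hmem
    have h2 : (p : 𝓞 K) ∈ (Q σ).under (𝓞 K) := by
      rw [Ideal.under, Ideal.mem_comap, map_natCast]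
      exact h1
    rw [← (hQ σ).2.over] at h2
    rw [Nat.cast_mul]
    exact Ideal.mul_mem_right _ _ h2
  -- the modulus `a = ∏_σ ℓ_σ`
  set a : ℕ := ∏ σ, ℓ σ with hadef
  have ha0 : 0 < a := Finset.prod_pos fun σ _ => (hvprime σ).pos
  have haN : Nat.Coprime a N := Nat.Coprime.prod_left fun σ _ => hℓN σ
  have haσ : ∀ σ, (a : 𝓞 K) ∈ (vσ σ).asIdeal := by
    intro σ
    obtain ⟨c, hc⟩ : ℓ σ ∣ a := Finset.dvd_prod_of_mem ℓ (Finset.mem_univ σ)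
    rw [hc, Nat.cast_mul]
    exact Ideal.mul_mem_right _ _ (hℓmem σ)
  refine ⟨a, ha0, haN, ?_⟩
  -- the main point
  intro x hxE hx
  obtain ⟨y₀, z, hz0, hzcop, hxeq⟩ := hx
  have hx0 : (x : K) ≠ 0 := x.ne_zero
  have hzpow : z ^ n = z ^ (n - 1) * z := by rw [← pow_succ, Nat.sub_add_cancel hn]
  -- `x = x₁ / z`, `x₁ = z + a y₀`
  set x₁ : 𝓞 K := z + a * y₀ with hx₁def
  have hxdiv : (x : K) = algebraMap (𝓞 K) K x₁ / algebraMap (𝓞 K) K z :=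
    Chevalley1951.eq_div_of_sub_one_eq hz0 hxeq
  have hzK0 : algebraMap (𝓞 K) K z ≠ 0 := hz0
  -- an `n`-th root `y` of `x` in `L`
  obtain ⟨Y, hY⟩ := hrootx x hxE
  set y : L := (Y : L) with hydef
  have hyn : y ^ n = algebraMap K L (x : K) := by
    rw [hydef, ← Units.val_pow_eq_pow_val, hY, hφval]
  -- the integral `n`-th root `y' = y z` of `u = x₁ z^{n-1}`
  set u : 𝓞 K := x₁ * z ^ (n - 1) with hudef
  set zL : L := algebraMap K L (algebraMap (𝓞 K) K z) with hzLdef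
  have hzL0 : zL ≠ 0 := (_root_.map_ne_zero _).mpr hzK0
  set y' : L := y * zL with hy'def
  have hK : (x : K) * (algebraMap (𝓞 K) K z) ^ n = algebraMap (𝓞 K) K u := by
    rw [hxdiv, hudef, map_mul, map_pow, ← map_pow, hzpow, map_mul, map_pow]
    field_simp
  have hy'n : y' ^ n = algebraMap K L (algebraMap (𝓞 K) K u) := by
    rw [hy'def, mul_pow, hyn, hzLdef, ← map_pow, ← map_mul, hK]
  have hy'int : IsIntegral ℤ y' := by
    refine IsIntegral.of_pow hn ?_
    rw [hy'n]
    exact (RingOfIntegers.isIntegral_coe u).algebraMap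
  set yO : 𝓞 L := ⟨y', hy'int⟩ with hyOdef
  have hyOn : yO ^ n = algebraMap (𝓞 K) (𝓞 L) u := by
    apply RingOfIntegers.coe_injective
    rw [map_pow]
    change y' ^ n = algebraMap (𝓞 L) L (algebraMap (𝓞 K) (𝓞 L) u)
    rw [hy'n, ← IsScalarTower.algebraMap_apply, ← IsScalarTower.algebraMap_apply]
  -- `ζ` as an algebraic integer
  have hζint : IsIntegral ℤ ζ := hζ.isIntegral hn
  set ζO : 𝓞 L := ⟨ζ, hζint⟩ with hζOdef
  have hζO : IsPrimitiveRoot ζO n :=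
    IsPrimitiveRoot.of_map_of_injective (f := algebraMap (𝓞 L) L)
      (by exact hζ) RingOfIntegers.coe_injective
  -- `u ≡ z^n (mod 𝔮_σ)`: `u - z^n = a y₀ z^{n-1}`
  have huz : u - z ^ n = (a : 𝓞 K) * (y₀ * z ^ (n - 1)) := by
    rw [hzpow, hudef, hx₁def]
    ring
  -- every `σ ∈ H` fixes `y'`, hence `y`
  have hfix : ∀ σ ∈ H, σ y = y := by
    intro σ hσ
    have hσζ : σ ζ = ζ :=
      (IntermediateField.mem_fixingSubgroup_iff _ _).mp hσ ζ
        (IntermediateField.mem_adjoin_simple_self K ζ)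
    have hσζO : σ • ζO = ζO := by
      apply RingOfIntegers.coe_injective
      exact hσζ
    haveI := (hQ σ).1
    have hzQ : z ∉ (Q σ).under (𝓞 K) := by
      rw [← (hQ σ).2.over]
      exact Chevalley1951.notMem_of_isCoprime_of_mem hzcop (haσ σ)
    have huzQ : u - z ^ n ∈ (Q σ).under (𝓞 K) := by
      rw [← (hQ σ).2.over, huz]
      exact Ideal.mul_mem_right _ _ (haσ σ)
    have h := Chevalley1951.smul_eq_self_of_isArithFrobAt_of_sub_pow_mem (Q σ) (hfrob σ) (hpQ σ)
      hζO hσζO u z hzQ huzQ hyOn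
    have h' : σ y' = y' := congrArg (algebraMap (𝓞 L) L) h
    rw [hy'def, map_mul, hzLdef, AlgEquiv.commutes, ← hzLdef] at h'
    exact mul_right_cancel₀ hzL0 h'
  -- hence `y ∈ K(ζ)`
  have hyK' : y ∈ K' := by
    rw [hK'def, ← IsGalois.fixedField_fixingSubgroup K⟮ζ⟯, IntermediateField.mem_fixedField_iff]
    exact hfix
  -- the descent
  have hyx : ∃ y ∈ K⟮ζ⟯, y ^ p ^ t = algebraMap K L (x : K) :=
    ⟨y, hyK', by rw [← hndef]; exact hyn⟩
  obtain ⟨w, hw⟩ := Chevalley1951.exists_eq_pow_or_eq_neg_pow_of_mem_adjoin hp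
    (by omega : 2 ≤ t) hζ hx0 hyx
  have ht1 : t - 1 = f + 1 := by omega
  rw [ht1, pow_succ' p f, pow_mul] at hw
  have hw0 : w ^ p ≠ 0 := by
    intro h0
    rw [h0, zero_pow (pow_ne_zero f hp0), neg_zero, or_self] at hw
    exact hx0 hw
  have hneg1 : (-1 : Kˣ) ∈ CommGroup.torsion Kˣ := by
    rw [CommGroup.mem_torsion, isOfFinOrder_iff_pow_eq_one]
    exact ⟨2, two_pos, neg_one_sq⟩
  rcases hw with h | h
  · exact ⟨Units.mk0 (w ^ p) hw0, 1, one_mem _, by rw [Units.val_one, one_mul, Units.val_mk0, h]⟩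
  · exact ⟨Units.mk0 (w ^ p) hw0, -1, hneg1,
      by rw [Units.val_neg, Units.val_one, Units.val_mk0, h, neg_one_mul]⟩

end PrimePow

/-! ### §4. Step 2: arbitrary exponents, modulo roots of unity (Chevalley §2) -/

section AnyExponent

variable {K : Type} [Field K] [NumberField K]

/-- **Chevalley's Théorème 1 for `E = ⟨s⟩`, arbitrary exponent `X`, modulo roots of unity** (§2, p. 37:
«on peut se ramener au cas où `m` est puissance d'un nombre premier … Soit `a` le p.p.c.m. des `a_i` …
`x` est puissance `m`-ième»; here the moduli of coprime exponents are multiplied and the conclusions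
combined by Bezout in `Kˣ`, the tree's `Chevalley1951.exists_torsion_mul_pow_of_coprime`): there is
`a > 0` prime to `N` such that every `x ∈ ⟨s⟩` with `x ≡ 1 (mod a)` (Hasse) is `ξ w^X` with `ξ` a root
of unity of `K` and `w ∈ Kˣ`. [cite: ChevalleyDeuxTheoremes1951, Thm 1, §2 (p. 37)] -/
theorem Chevalley1951.fg_exists_modulus_nat (s : Finset Kˣ) (X : ℕ) (hX : 0 < X) {N : ℕ}
    (hN : 0 < N) :
    ∃ a : ℕ, 0 < a ∧ Nat.Coprime a N ∧
      ∀ x : Kˣ, x ∈ Subgroup.closure (s : Set Kˣ) →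
        (∃ y z : 𝓞 K, (z : K) ≠ 0 ∧ IsCoprime z (a : 𝓞 K) ∧
            (x : K) - 1 = (a : K) * (y : K) / (z : K)) →
          ∃ (w ξ : Kˣ), ξ ∈ CommGroup.torsion Kˣ ∧ x = ξ * w ^ X := by
  induction X using Nat.recOnPosPrimePosCoprime with
  | zero => exact absurd hX (lt_irrefl 0)
  | one =>
    refine ⟨1, one_pos, Nat.coprime_one_left N, fun x _ _ => ⟨x, 1, one_mem _, ?_⟩⟩
    rw [pow_one, one_mul]
  | prime_pow p k hp hk =>
    obtain ⟨a, ha, haN, h⟩ := Chevalley1951.fg_exists_modulus_primePow s hp k hN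
    refine ⟨a, ha, haN, fun x hxE hx => ?_⟩
    obtain ⟨w, ξ, hξ, hw⟩ := h x hxE hx
    exact ⟨w, ξ, hξ, Units.ext (by rw [Units.val_mul, Units.val_pow_eq_pow_val]; exact hw)⟩
  | coprime A B hA hB hAB ihA ihB =>
    obtain ⟨a₁, ha₁, ha₁N, h₁⟩ := ihA (by omega)
    obtain ⟨a₂, ha₂, ha₂N, h₂⟩ := ihB (by omega)
    refine ⟨a₁ * a₂, Nat.mul_pos ha₁ ha₂, Nat.Coprime.mul_left ha₁N ha₂N, fun x hxE hx => ?_⟩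
    exact Chevalley1951.exists_torsion_mul_pow_of_coprime (CommGroup.torsion Kˣ) hAB
      (h₁ x hxE (Chevalley1951.hasse_of_dvd (dvd_mul_right a₁ a₂) hx))
      (h₂ x hxE (Chevalley1951.hasse_of_dvd (dvd_mul_left a₂ a₁) hx))

end AnyExponent

/-! ### §5. Step 3: the theorem (Chevalley §1 and the closing step) -/

/-- **Chevalley 1951, Théorème 1 — PROVED, for an arbitrary finitely generated subgroup `E ≤ Kˣ`**
(«tout élément `x` de `E` qui est `≡ 1 (mod a)` est puissance `m`-ième d'un élément de `E`», `a`
prime to the given `N`): discharge of the named fact `Chevalley1951.thm1`.  With `E = ⟨s⟩ ≤ S.unit K`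
(`exists_finset_closure_le_sUnit`), the saturation exponent `n₀` of `E` in the `S`-units
(`exists_saturation_exponent`, Chevalley §1), `D = ∏_{v ∈ S} N𝔭_v`, an auxiliary prime
`ℓ₀ > N · #μ(K) · D` with a place `t₀ ∣ ℓ₀` and `c₀ = #(𝓞 K/𝔭_{t₀})ˣ`: step 2
(`fg_exists_modulus_nat`) with exponent `c₀ n₀ m` and `N ℓ₀` gives `a₁`, and `a = a₁ ℓ₀` works — if
`x ∈ E`, `x ≡ 1 (mod a)`, then `x = ξ w^{c₀ n₀ m}` with `ξ ∈ μ(K)` and `w` an `S`-unit, and modulo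
`𝔭_{t₀}` one has `x ≡ 1` and `(w^{n₀ m})^{c₀} ≡ 1` (`valuation_pow_card_sub_one_lt_one_of_mem_sUnit`),
so `ξ ≡ 1 (mod 𝔭_{t₀})`, `ξ = 1` (`Chevalley1951.eq_one_of_pow_eq_one_of_sub_one_mem`), and
`x = ((w^{c₀})^{n₀})^m` with `(w^{c₀})^{n₀} ∈ E` by the choice of `n₀`.  Inputs: Chebotarev's density
theorem and the cyclotomic descent (through `fg_exists_modulus_primePow`), the `S`-unit theorem
(through `exists_saturation_exponent`).
[cite: ChevalleyDeuxTheoremes1951, Thm 1 (p. 36), proof §§1–5 (pp. 36–40)] -/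
theorem Chevalley1951.thm1_holds : Chevalley1951.thm1 := by
  intro K _ _ E hE m hm N hN
  -- generators, support, saturation exponent
  obtain ⟨s, hs⟩ := hE
  obtain ⟨S, hS⟩ := Chevalley1951.exists_finset_closure_le_sUnit (K := K) s
  rw [hs] at hS
  obtain ⟨n₀, hn₀, hsat⟩ := Chevalley1951.exists_saturation_exponent S hS
  -- `D = ∏_{v ∈ S} N𝔭_v` lies in every prime of `S`
  set D : ℕ := ∏ v ∈ S, Ideal.absNorm v.asIdeal with hDdef
  have hD0 : 0 < D := by
    refine Finset.prod_pos fun v _ => Nat.pos_of_ne_zero ?_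
    rw [Ne, Ideal.absNorm_eq_zero_iff]
    exact v.ne_bot
  have hDS : ∀ v ∈ S, (D : 𝓞 K) ∈ v.asIdeal := fun v hv => by
    obtain ⟨c, hc⟩ : Ideal.absNorm v.asIdeal ∣ D :=
      Finset.dvd_prod_of_mem (fun v : HeightOneSpectrum (𝓞 K) => Ideal.absNorm v.asIdeal) hv
    rw [hc, Nat.cast_mul]
    exact Ideal.mul_mem_right _ _ (Ideal.absNorm_mem _)
  -- an auxiliary prime `ℓ₀ > N · #μ(K) · D` and a place `t₀` above it
  set w₀ : ℕ := Units.torsionOrder K with hw₀def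
  have hw₀ : 0 < w₀ := Units.torsionOrder_pos K
  obtain ⟨ℓ₀, t₀, hℓ₀, hℓ₀B, hℓ₀t₀, ht₀⟩ :=
    Chevalley1951.exists_prime_gt_mem_place (K := K) (N * w₀ * D)
  have hNB : N ≤ N * w₀ * D :=
    le_trans (Nat.le_mul_of_pos_right N hw₀) (Nat.le_mul_of_pos_right _ hD0)
  have hw₀B : w₀ ≤ N * w₀ * D :=
    le_trans (Nat.le_mul_of_pos_left w₀ hN) (Nat.le_mul_of_pos_right _ hD0)
  have hDB : D ≤ N * w₀ * D := Nat.le_mul_of_pos_left D (Nat.mul_pos hN hw₀)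
  have hℓ₀N : Nat.Coprime ℓ₀ N := by
    rw [Nat.Prime.coprime_iff_not_dvd hℓ₀]
    intro h
    have := Nat.le_of_dvd hN h
    omega
  have hw₀t₀ : ((Units.torsionOrder K : ℕ) : 𝓞 K) ∉ t₀.asIdeal := ht₀ w₀ hw₀ hw₀B
  have hDt₀ : (D : 𝓞 K) ∉ t₀.asIdeal := ht₀ D hD0 hDB
  have ht₀S : t₀ ∉ S := fun h => hDt₀ (hDS t₀ h)
  haveI : Finite (𝓞 K ⧸ t₀.asIdeal) := Ideal.finiteQuotientOfFreeOfNeBot _ t₀.ne_bot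
  set c₀ : ℕ := Nat.card (𝓞 K ⧸ t₀.asIdeal)ˣ with hc₀def
  have hc₀ : 0 < c₀ := Nat.card_pos
  -- step 2 with exponent `c₀ n₀ m` and `N ℓ₀`
  obtain ⟨a₁, ha₁, ha₁N, hmain⟩ := Chevalley1951.fg_exists_modulus_nat s (c₀ * n₀ * m)
    (Nat.mul_pos (Nat.mul_pos hc₀ hn₀) hm) (Nat.mul_pos hN hℓ₀.pos)
  -- the modulus `a = a₁ ℓ₀`
  refine ⟨a₁ * ℓ₀, Nat.mul_pos ha₁ hℓ₀.pos,
    Nat.Coprime.mul_left (Nat.Coprime.coprime_dvd_right (dvd_mul_right N ℓ₀) ha₁N) hℓ₀N, ?_⟩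
  intro x hxE hx
  have hxs : x ∈ Subgroup.closure (s : Set Kˣ) := by rw [hs]; exact hxE
  -- `x = ξ w^{c₀ n₀ m}`
  obtain ⟨w, ξ, hξ, hxw⟩ := hmain x hxs (Chevalley1951.hasse_of_dvd (dvd_mul_right a₁ ℓ₀) hx)
  -- `x ≡ 1 (mod t₀)`
  obtain ⟨y₀, z, hz0, hzcop, hxeq⟩ := hx
  have hat₀ : ((a₁ * ℓ₀ : ℕ) : 𝓞 K) ∈ t₀.asIdeal := by
    rw [Nat.cast_mul]
    exact Ideal.mul_mem_left _ _ hℓ₀t₀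
  have hxt₀ : t₀.valuation K ((x : K) - 1) < 1 :=
    Chevalley1951.valuation_sub_one_lt_one_of_hasse hzcop hxeq hat₀
  -- `w` is an `S`-unit: `w^{c₀ n₀ m · ord ξ} = x^{ord ξ} ∈ E`
  have hξfin : IsOfFinOrder ξ := by
    have h := hξ
    rw [CommGroup.mem_torsion] at h
    exact h
  obtain ⟨k, hk, hξk⟩ := hξfin.exists_pow_eq_one
  have hwU : w ∈ (S : Set (HeightOneSpectrum (𝓞 K))).unit K := by
    refine Chevalley1951.mem_sUnit_of_pow_mem (Nat.mul_pos (Nat.mul_pos (Nat.mul_pos hc₀ hn₀) hm) hk)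
      (hS ?_)
    have h1 : w ^ (c₀ * n₀ * m * k) = x ^ k := by
      rw [pow_mul, hxw, mul_pow, hξk, one_mul]
    rw [h1]
    exact E.pow_mem hxE k
  -- `W = w^{n₀ m}` is an `S`-unit with `W^{c₀} ≡ 1 (mod t₀)`, and `x = ξ W^{c₀}`
  set W : Kˣ := w ^ (n₀ * m) with hWdef
  have hWU : W ∈ (S : Set (HeightOneSpectrum (𝓞 K))).unit K := Subgroup.pow_mem _ hwU _
  have hxW : (x : K) = (ξ : K) * (W : K) ^ c₀ := by
    rw [hxw, hWdef, Units.val_mul, Units.val_pow_eq_pow_val, Units.val_pow_eq_pow_val, ← pow_mul,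
      show n₀ * m * c₀ = c₀ * n₀ * m by ring]
  have hWt₀ : t₀.valuation K (W : K) = 1 := hWU t₀ (by exact_mod_cast ht₀S)
  have hWc₀ : t₀.valuation K ((W : K) ^ c₀ - 1) < 1 :=
    Chevalley1951.valuation_pow_card_sub_one_lt_one_of_mem_sUnit hDS hDt₀ hWU
  -- hence `ξ ≡ 1 (mod t₀)`
  have hξt₀ : t₀.valuation K ((ξ : K) - 1) < 1 := by
    have hW0 : (W : K) ^ c₀ ≠ 0 := pow_ne_zero _ W.ne_zero
    have hξeq : (ξ : K) - 1 = ((x : K) - (W : K) ^ c₀) * ((W : K) ^ c₀)⁻¹ := by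
      rw [hxW]; field_simp
    rw [hξeq, map_mul, map_inv₀, map_pow, hWt₀, one_pow, inv_one, mul_one,
      show (x : K) - (W : K) ^ c₀ = ((x : K) - 1) + (1 - (W : K) ^ c₀) by ring]
    refine Valuation.map_add_lt _ hxt₀ ?_
    rwa [← Valuation.map_neg, neg_sub]
  -- and `ξ = 1`
  obtain ⟨ξ₀, hξ₀tor, hξ₀⟩ := Chevalley1951.exists_torsion_eq_of_mem_torsion hξ
  have hξ₀1 : (ξ₀ : 𝓞 K) - 1 ∈ t₀.asIdeal := by
    rw [← Chevalley1951.valuation_algebraMap_lt_one_iff t₀, map_sub, map_one, hξ₀]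
    exact hξt₀
  have hξ₀pow : ((ξ₀ : 𝓞 K)) ^ Units.torsionOrder K = 1 := by
    have h3 : ξ₀ ∈ rootsOfUnity (Units.torsionOrder K) (𝓞 K) := by
      rw [Units.rootsOfUnity_eq_torsion]; exact hξ₀tor
    rw [mem_rootsOfUnity] at h3
    have h4 := congrArg (fun z : (𝓞 K)ˣ => (z : 𝓞 K)) h3
    simpa using h4
  have hξ₀eq : (ξ₀ : 𝓞 K) = 1 :=
    Chevalley1951.eq_one_of_pow_eq_one_of_sub_one_mem t₀.asIdeal hw₀t₀ hξ₀pow hξ₀1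
  have hξ1 : ξ = 1 := by
    apply Units.ext
    rw [Units.val_one, ← hξ₀, hξ₀eq, map_one]
  -- conclusion: `x = ((w^{c₀})^{n₀})^m` with `(w^{c₀})^{n₀} ∈ E`
  rw [hξ1, one_mul] at hxw
  refine ⟨(w ^ c₀) ^ n₀, hsat (w ^ c₀) (n₀ * m) (Nat.mul_pos hn₀ hm) ?_, ?_⟩
  · rw [← pow_mul, ← mul_assoc, ← hxw]
    exact hxE
  · rw [hxw, ← pow_mul, ← pow_mul, mul_assoc]

end Literature.NumberTheory.NumberFields
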